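import Summits.QuantumFields.YangMills.Theorems.IRcofAdaptedSpectralDataCore
import Summits.QuantumFields.YangMills.Theorems.BalabanLadderIRcofTemporalTwistSubadditivity
import Literature.MathematicalPhysics.QuantumFieldTheory.WilsonFinTorusMagneticSliceKernel
import HarnessLib

/-!
# Adapted spectral data for a finite abelian group of central temporal twists; the e-projection `projZ` in an adapted
# eigenbasis; the SPECTRAL REDUCTION of interlacing (crux `IRcof` ⟨stmt-QuantumFields-26930⟩, line `flux_interlacing_v2`
# 1bda929b912cc52d, stub I = `stub_fluxInterlacingEv : FluxInterlacingEv` — helper lane, a START, not a proof of I)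

Cell `ym-gapexp` (R2c), director-ym R660-ym (1)(iv); critic of record `ymfull-r2c-crit-1` (CUT-5/6/10).  Sequel of
`IRcofAdaptedSpectralDataCore.lean` (✓p818348: one cyclic twist group on the plane `(0,3)`).

WHAT IS PROVED (finite-volume transfer-matrix bookkeeping at ONE box and ONE `β ≥ 0`; def-free):

* ★ `adaptedSpectralData_twistGroup` — for ANY finite abelian group `Γ` of central temporal twist vectors `Z : Γ → (Fin 4 → G)`
  (`Z 0 = 1`, `Z (a+b) = Z a · Z b`, temporal components central: 't Hooft's `Ω[k]`, `k ∈ Z(G)³`) the `L²` transfer operator of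
  `finTorusSliceKernel ρ β` has a Hilbert eigenbasis ADAPTED to the flux projection `P = |Γ|⁻¹ Σ_a U_a` (Koopman isometries of the
  slice twists `finSliceTwist (Z a)`): `Z(b, m+2) = Σ λᵢ^{m+2}` and `|Γ|⁻¹ Σ_a Z^{(Z a)}(b, m+2) = Σ λᵢ^{m+2} wᵢ`, `λᵢ ≥ 0`, `wᵢ ∈ {0,1}`
  ('t Hooft (5.3) `Tr P(e=0) e^{−βH}` in an adapted eigenbasis; Serre's projection formula).  The proof is the one of
  `IRcofAdaptedSpectralDataCore.adaptedSpectralDataAt` with the cyclic group replaced by `Γ`.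
* ★ `adaptedSpectralData_projZ` — the case `Γ = (Fin n)³`, `Z k = (z^{k₀}, z^{k₁}, z^{k₂}, ·)` (`zVec`): the e-PROJECTED cold-box partition
  function `projZ ρ β z n L` of `TemporalTwistSubadditivity` (the currency of line `flux_interlacing_v2`: `InterlacedAt`, `projDefect`,
  `NeutralPurityCof`, `FluxInterlacingEv` are all stated over it) is `Σ λᵢ^{m+2} wᵢ` in an adapted eigenbasis, next to `Z = Σ λᵢ^{m+2}`
  (`eTwist_eq_elecMag` + `wilsonFinTorusTensorTwistedPartition_elecMag_one` identify `W{eTwist z k}` with `Z^{(zVec z k)}`).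
* ★ `interlaced_of_chargedWeight_le` — THE SPECTRAL REDUCTION OF INTERLACING: in such a basis the charged weight is
  `C(t) = Z(t) − projZ(t) = Σ_{wᵢ=0} λᵢ^t` and the neutral traces are `N(t) = projZ(t) = Σ_{wᵢ=1} λᵢ^t`; hence the conclusion
  `InterlacedAt ρ β z n κ L` of stub I (VERBATIM body: `Z(L³×t) ≤ projZ(t) + κ·(projZ(t) − √projZ(2t))`, `t = L/4`) holds as soon as
  `Σ_{wᵢ=0} λᵢ^t ≤ κ · (Σ_{wᵢ=1} λᵢ^t − √(Σ_{wᵢ=1} λᵢ^{2t}))` — «the electric-flux spectral weight is at most `κ` times the neutral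
  excitation» — for SOME adapted eigenbasis (packaged as an `∃` over the data together with the two trace formulas).

WHAT THIS IS NOT.  Stub I (`FluxInterlacingEv`: neutral `ε₀`-purity ⇒ interlacing, at weak coupling, for simply-connected simple Lie `G`)
is IDEA-NEEDED (CUT-5/10: it OWES confinement at the fixed physical scale `ln(2d/ε₀)/m`); nothing here proves it, nor `NeutralPurityCof`,
`IRcof`, `IR`, or the Yang–Mills mass gap (Clay), which is NOT proved.  This file only moves I to its honest spectral form.
Finite-volume ∕ conditional.

References: G. 't Hooft, Nucl. Phys. B 153 (1979) 141, §4 (4.2)–(4.5), §5 (5.1)–(5.4); J.-P. Serre, *Linear Representations of Finite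
Groups* (1977) §2.6 Thm 8; I. Montvay, G. Münster, *Quantum Fields on a Lattice* (1994) §3.2.6 (3.145); M. Reed, B. Simon, *Methods of
Modern Mathematical Physics* I (1980) Thm. VI.16, VI.22–23.
-/

noncomputable section

open scoped BigOperators ENNReal
open MeasureTheory Filter Function
open Literature.Analysis.OperatorTheory Literature.MathematicalPhysics.QuantumFieldTheory
open Summit.QuantumFields.YangMills.Cruxes.IRcof.TemporalTwistSubadditivity (eTwist zVec projZ eTwist_eq_elecMag
  pow_eq_pow_mod_of_pow_eq_one)

namespace Summit.QuantumFields.YangMills.Theorems.IRcofFluxProjectionAdaptedSpectralData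

variable {G : Type} [Group G] [TopologicalSpace G] [IsTopologicalGroup G] [CompactSpace G]
  [MeasurableSpace G] [BorelSpace G] [SecondCountableTopology G] {N : ℕ} {ρ : G →* Matrix (Fin N) (Fin N) ℂ}

/-! ### §1 Adapted spectral data for a finite abelian twist group -/

/-- ★ **Adapted spectral data for a finite abelian group of central temporal twists** (`β ≥ 0`, continuous unitary `ρ`, every box
`b₁ × b₂ × b₃`): for `Z : Γ → (Fin 4 → G)` with `Z 0 = 1`, `Z (a + b) = Z a · Z b` and central temporal components, there are
`λᵢ ≥ 0`, `wᵢ ∈ {0,1}` with `Z(b, m+2) = Σ λᵢ^{m+2}` and `|Γ|⁻¹ Σ_{a ∈ Γ} Z^{(Z a)}(b, m+2) = Σ λᵢ^{m+2} wᵢ` — the trace of `𝕋^{m+2}`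
over the `Γ`-invariant (zero electric flux) sector in an eigenbasis adapted to the flux projection.
[cite: tHooft1979Flux, §5 (5.1)–(5.4)] [cite: MontvayMunster1994, §3.2.6 (3.145)] [cite: ReedSimonI1980, Thm. VI.16 and Thm. VI.22–23] -/
theorem adaptedSpectralData_twistGroup (hρ : Continuous ρ) (hρu : ∀ x, ρ x ∈ Matrix.unitaryGroup (Fin N) ℂ) {β : ℝ}
    (hβ : 0 ≤ β) {Γ : Type} [AddCommGroup Γ] [Fintype Γ] {Z : Γ → Fin 4 → G} (hZ0 : Z 0 = 1)
    (hZadd : ∀ a b, Z (a + b) = Z a * Z b) (hZc : ∀ (a : Γ) (i : Fin 3), Z a i.castSucc ∈ Subgroup.center G)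
    (b₁ b₂ b₃ : ℕ) :
    ∃ (ι : Type) (lam w : ι → ℝ), (∀ i, 0 ≤ lam i) ∧ (∀ i, w i = 0 ∨ w i = 1) ∧
      (∀ m : ℕ, HasSum (fun i => lam i ^ (m + 2)) (wilsonFinTorusPartition ρ β b₁ b₂ b₃ (m + 2))) ∧
      (∀ m : ℕ, HasSum (fun i => lam i ^ (m + 2) * w i)
        ((Fintype.card Γ : ℝ)⁻¹ * ∑ a : Γ, wilsonFinTorusTwistedPartition ρ β (Z a) b₁ b₂ b₃ (m + 2))) := by
  -- the slice, its Haar measure, the slice kernel and its transfer operator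
  set μ : Measure (FinSpatialSite b₁ b₂ b₃ × Fin 3 → G) :=
    Measure.pi fun _ : FinSpatialSite b₁ b₂ b₃ × Fin 3 => haarProbability G with hμ
  set K : (FinSpatialSite b₁ b₂ b₃ × Fin 3 → G) → (FinSpatialSite b₁ b₂ b₃ × Fin 3 → G) → ℝ :=
    finTorusSliceKernel ρ β with hKdef
  have hK : StronglyMeasurable (uncurry K) := stronglyMeasurable_uncurry_finTorusSliceKernel ρ hρ β
  obtain ⟨C, hC⟩ := exists_norm_finTorusSliceKernel_le (b₁ := b₁) (b₂ := b₂) (b₃ := b₃) ρ hρ β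
  have hsymm : ∀ x y, K x y = K y x := finTorusSliceKernel_symm ρ hρu β
  obtain ⟨A, hA⟩ := exists_kernelOp (μ := μ) hK hC
  have hsa : IsSelfAdjoint A := isSelfAdjoint_kernelOp hK hC hsymm hA
  have hC0 : 0 ≤ C := (norm_nonneg _).trans (hC 1 1)
  have hcpt : IsCompactOperator A := isCompactOperator_kernelOp hC hC0 hA
  have hApos : ∀ φ : Lp ℝ 2 μ, 0 ≤ @inner ℝ _ _ (A φ) φ := fun φ => by
    rw [real_inner_comm]
    exact inner_kernelOp_self_nonneg hA (posType_finTorusSliceKernel ρ hρ hρu hβ) φ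
  -- the slice twists `T a` of the twist group
  have hzmul : ∀ e e' : Γ, Z e * Z e' = Z (e + e') := fun e e' => (hZadd e e').symm
  set T : Γ → (FinSpatialSite b₁ b₂ b₃ × Fin 3 → G) → (FinSpatialSite b₁ b₂ b₃ × Fin 3 → G) :=
    fun e => finSliceTwist (Z e) with hT
  have hTmp : ∀ e, MeasurePreserving (T e) μ μ := fun e => measurePreserving_finSliceTwist (Z e)
  have hTT : ∀ e e' x, T e (T e' x) = T (e + e') x := fun e e' x => by
    simp only [hT, finSliceTwist_finSliceTwist, hzmul]
  have hT0 : ∀ x, T 0 x = x := fun x => by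
    simp only [hT, hZ0, finSliceTwist_one, id]
  have hTinv : ∀ e x, T e (T (-e) x) = x := fun e x => by rw [hTT, add_neg_cancel, hT0]
  have hTinv' : ∀ e x, T (-e) (T e x) = x := fun e x => by rw [hTT, neg_add_cancel, hT0]
  have hKT : ∀ e x y, K (T e x) (T e y) = K x y := fun e x y => finTorusSliceKernel_finSliceTwist ρ (hZc e) β x y
  have hcov : ∀ (e) (F : (FinSpatialSite b₁ b₂ b₃ × Fin 3 → G) → ℝ), ∫ x, F (T e x) ∂μ = ∫ x, F x ∂μ :=
    fun e F => IRcofAdaptedSpectralDataCore.integral_comp_finSliceTwist (Z e) F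
  -- the Koopman isometries `U e φ = φ ∘ T e` and the flux projection `P = n⁻¹ Σ_e U e`
  set U : Γ → (Lp ℝ 2 μ →L[ℝ] Lp ℝ 2 μ) :=
    fun e => (Lp.compMeasurePreservingₗᵢ ℝ (T e) (hTmp e)).toContinuousLinearMap with hU
  have hUae : ∀ (e) (φ : Lp ℝ 2 μ), (U e φ : (FinSpatialSite b₁ b₂ b₃ × Fin 3 → G) → ℝ) =ᵐ[μ] fun x => φ (T e x) :=
    fun e φ => Lp.coeFn_compMeasurePreserving φ (hTmp e)
  have hUU : ∀ (e e') (φ : Lp ℝ 2 μ), U e (U e' φ) = U (e' + e) φ := by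
    intro e e' φ
    refine Lp.ext ?_
    filter_upwards [hUae e (U e' φ), (hTmp e).quasiMeasurePreserving.ae_eq_comp (hUae e' φ), hUae (e' + e) φ]
      with x h1 h2 h3
    rw [h1, h3]
    have h2' : (U e' φ) (T e x) = φ (T e' (T e x)) := h2
    rw [h2', hTT]
  have hUadj : ∀ (e) (φ ψ : Lp ℝ 2 μ), @inner ℝ _ _ (U e φ) ψ = @inner ℝ _ _ φ (U (-e) ψ) := by
    intro e φ ψ
    rw [inner_eq_integral, inner_eq_integral]
    have h1 : ∫ x, (U e φ) x * ψ x ∂μ = ∫ x, φ (T e x) * ψ x ∂μ :=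
      integral_congr_ae (by filter_upwards [hUae e φ] with x hx; rw [hx])
    have h2 : ∫ x, φ x * (U (-e) ψ) x ∂μ = ∫ x, φ x * ψ (T (-e) x) ∂μ :=
      integral_congr_ae (by filter_upwards [hUae (-e) ψ] with x hx; rw [hx])
    rw [h1, h2, ← hcov e (fun x => φ x * ψ (T (-e) x))]
    refine integral_congr_ae (Eventually.of_forall fun x => ?_)
    simp only [hTinv']
  have hAU : ∀ (e) (φ : Lp ℝ 2 μ), A (U e φ) = U e (A φ) := by
    intro e φ
    refine Lp.ext ?_
    have h3 : ∀ x, ∫ y, K x y * (U e φ) y ∂μ = ∫ y, K (T e x) y * φ y ∂μ := by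
      intro x
      have h1 : ∫ y, K x y * (U e φ) y ∂μ = ∫ y, K x y * φ (T e y) ∂μ :=
        integral_congr_ae (by filter_upwards [hUae e φ] with y hy; rw [hy])
      rw [h1, ← hcov (-e) (fun y => K x y * φ (T e y))]
      refine integral_congr_ae (Eventually.of_forall fun y => ?_)
      simp only
      rw [hTinv, ← hKT e x (T (-e) y), hTinv]
    filter_upwards [hA (U e φ), hUae e (A φ), (hTmp e).quasiMeasurePreserving.ae_eq_comp (hA φ)] with x h1 h2 h4
    rw [h1, h3 x, h2]
    exact h4.symm
  set P : Lp ℝ 2 μ →L[ℝ] Lp ℝ 2 μ := (Fintype.card Γ : ℝ)⁻¹ • ∑ e, U e with hP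
  have hPapply : ∀ φ : Lp ℝ 2 μ, P φ = (Fintype.card Γ : ℝ)⁻¹ • ∑ e, U e φ := fun φ => by
    simp only [hP, smul_apply, sum_apply]
  have hn' : (Fintype.card Γ : ℝ) ≠ 0 := Nat.cast_ne_zero.2 Fintype.card_ne_zero
  have hP2 : ∀ φ, P (P φ) = P φ := by
    intro φ
    have hsumU : ∀ e, ∑ e', U e (U e' φ) = ∑ e'', U e'' φ := fun e => by
      simp_rw [hUU]
      exact Fintype.sum_equiv (Equiv.addRight e) _ _ fun e' => rfl
    rw [hPapply (P φ), hPapply φ]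
    simp_rw [map_smul, map_sum, hsumU, Finset.sum_const, Finset.card_univ, ← Nat.cast_smul_eq_nsmul ℝ, smul_smul]
    rw [inv_mul_cancel_left₀ hn']
  have hPsym : ∀ φ ψ : Lp ℝ 2 μ, @inner ℝ _ _ (P φ) ψ = @inner ℝ _ _ φ (P ψ) := by
    intro φ ψ
    rw [hPapply, hPapply, real_inner_smul_left, real_inner_smul_right, sum_inner, inner_sum]
    congr 1
    simp_rw [hUadj]
    exact Fintype.sum_equiv (Equiv.neg Γ) _ _ fun e => rfl
  have hPsa : IsSelfAdjoint P := by
    rw [ContinuousLinearMap.isSelfAdjoint_iff_isSymmetric]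
    intro φ ψ
    exact hPsym φ ψ
  have hcomm : ∀ φ, A (P φ) = P (A φ) := fun φ => by
    rw [hPapply, hPapply, map_smul, map_sum]
    simp_rw [hAU]
  -- ONE diagonalisation, adapted to `P`
  obtain ⟨s, bb, lam, w, hbs, hb, hlam0, hw, hPb⟩ :=
    IRcofAdaptedSpectralDataCore.exists_adapted_eigenbasis hcpt hsa hApos hPsa hP2 hcomm
  haveI : Fact ((2 : ℝ≥0∞) ≠ ⊤) := ⟨ENNReal.ofNat_ne_top⟩
  have hon : Orthonormal ℝ ((↑) : s → Lp ℝ 2 μ) := hbs ▸ bb.orthonormal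
  haveI : Countable s := (hon.countable_of_separableSpace (𝕜 := ℝ)).to_subtype
  -- the flux weight of an eigenvector: `n⁻¹ Σ_e ⟪U_e A bᵢ, A bᵢ⟫ = λᵢ² wᵢ`
  have hg : ∀ e i, ∫ x, (∫ y, K (T e x) y * bb i y ∂μ) * (∫ y, K x y * bb i y ∂μ) ∂μ =
      lam i * lam i * @inner ℝ _ _ (U e (bb i)) (bb i) := by
    intro e i
    have h1 : @inner ℝ _ _ (U e (A (bb i))) (A (bb i)) =
        ∫ x, (∫ y, K (T e x) y * bb i y ∂μ) * (∫ y, K x y * bb i y ∂μ) ∂μ := by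
      rw [inner_eq_integral]
      refine integral_congr_ae ?_
      filter_upwards [hUae e (A (bb i)), (hTmp e).quasiMeasurePreserving.ae_eq_comp (hA (bb i)), hA (bb i)]
        with x h1 h2 h3
      rw [h1, h3]
      have h2' : (A (bb i)) (T e x) = ∫ y, K (T e x) y * bb i y ∂μ := h2
      rw [h2']
    rw [← h1, hb i, map_smul, real_inner_smul_left, real_inner_smul_right, mul_assoc]
  have hflux : ∀ (m : ℕ) (i : s), (Fintype.card Γ : ℝ)⁻¹ * ∑ e, lam i ^ m *
      ∫ x, (∫ y, K (T e x) y * bb i y ∂μ) * (∫ y, K x y * bb i y ∂μ) ∂μ = lam i ^ (m + 2) * w i := by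
    intro m i
    simp_rw [hg]
    have h1 : (Fintype.card Γ : ℝ)⁻¹ * ∑ e, lam i ^ m * (lam i * lam i * @inner ℝ _ _ (U e (bb i)) (bb i)) =
        lam i ^ (m + 2) * @inner ℝ _ _ (P (bb i)) (bb i) := by
      rw [hPapply, real_inner_smul_left, sum_inner, Finset.mul_sum, Finset.mul_sum, Finset.mul_sum]
      exact Finset.sum_congr rfl fun e _ => by ring
    rw [h1]
    rcases eq_or_ne (lam i) 0 with h0 | h0
    · rw [h0, zero_pow (Nat.succ_ne_zero _), zero_mul, zero_mul]
    · rw [hPb i h0, real_inner_smul_left, real_inner_self_eq_norm_sq, bb.orthonormal.norm_eq_one i, one_pow, mul_one]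
  refine ⟨s, lam, w, hlam0, hw, fun m => ?_, fun m => ?_⟩
  · -- `Z(b, m+2) = Σ λᵢ^{m+2}` (Montvay–Münster (3.145))
    rw [wilsonFinTorusPartition_eq_integral_prod_finTorusSliceKernel_succ ρ hρ β b₁ b₂ b₃ m]
    exact hasSum_pow_integral_cyclic hK hC hsymm hA hb hlam0 m
  · -- `n⁻¹ Σ_e Z^{(gᵉ)}(b, m+2) = Σ λᵢ^{m+2} wᵢ` ('t Hooft (5.3) in the adapted eigenbasis)
    have he : ∀ e : Γ, HasSum (fun i : s => lam i ^ m *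
        ∫ x, (∫ y, K (T e x) y * bb i y ∂μ) * (∫ y, K x y * bb i y ∂μ) ∂μ)
        (wilsonFinTorusTwistedPartition ρ β (Z e) b₁ b₂ b₃ (m + 2)) := fun e => by
      rw [wilsonFinTorusTwistedPartition_eq_integral_iterate ρ hρ β (hZc e) b₁ b₂ b₃ m]
      exact hasSum_pow_integral_iterate_twisted hK hC hsymm hA hb (hTmp e).measurable m
    have hs := (hasSum_sum fun e (_ : e ∈ (Finset.univ : Finset Γ)) => he e).mul_left
      ((Fintype.card Γ : ℝ)⁻¹)
    refine hs.congr_fun fun i => ?_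
    exact (hflux m i).symm

/-! ### §2 The e-projected cold box `projZ` in an adapted eigenbasis -/

omit [TopologicalSpace G] [IsTopologicalGroup G] [CompactSpace G] [MeasurableSpace G] [BorelSpace G]
  [SecondCountableTopology G] in
/-- The twist vector of the zero label is trivial: `zVec z (0) = 1`. -/
theorem zVec_fin_zero (z : G) (q : ℕ) : zVec z (fun i => (((0 : Fin 3 → Fin (q + 1)) i : Fin (q + 1)) : ℕ)) = 1 := by
  funext μ
  unfold zVec
  split_ifs <;> simp

omit [TopologicalSpace G] [IsTopologicalGroup G] [CompactSpace G] [MeasurableSpace G] [BorelSpace G]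
  [SecondCountableTopology G] in
/-- The twist vectors form a representation of `(Fin n)³` when `z ^ n = 1`: `zVec z (k + k') = zVec z k · zVec z k'`
('t Hooft's group law `Ω[k] Ω[k'] = Ω[k + k']`, (4.4)). [cite: tHooft1979Flux, §4 (4.4)] -/
theorem zVec_fin_add {z : G} {q : ℕ} (hzn : z ^ (q + 1) = 1) (k k' : Fin 3 → Fin (q + 1)) :
    zVec z (fun i => (((k + k') i : Fin (q + 1)) : ℕ)) = zVec z (fun i => (k i : ℕ)) * zVec z (fun i => (k' i : ℕ)) := by
  funext μ
  unfold zVec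
  simp only [Pi.mul_apply, Pi.add_apply]
  split_ifs with h
  · rw [Fin.val_add, ← pow_eq_pow_mod_of_pow_eq_one hzn, pow_add]
  · simp

omit [TopologicalSpace G] [IsTopologicalGroup G] [CompactSpace G] [MeasurableSpace G] [BorelSpace G]
  [SecondCountableTopology G] in
/-- The temporal components of `zVec z e` are central when `z` is. -/
theorem zVec_castSucc_mem_center {z : G} (hz : z ∈ Subgroup.center G) (e : Fin 3 → ℕ) (i : Fin 3) :
    zVec z e i.castSucc ∈ Subgroup.center G := by
  unfold zVec
  split_ifs
  · exact Subgroup.pow_mem _ hz _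
  · exact Subgroup.one_mem _

/-- ★ **The e-projected cold box in an adapted eigenbasis** (`β ≥ 0`, continuous unitary `ρ`, central `z`, `0 < n`, `z ^ n = 1`, every
`L`): there are `λᵢ ≥ 0`, `wᵢ ∈ {0,1}` with `Z(L³ × (m+2)) = Σ λᵢ^{m+2}` and `projZ ρ β z n L (m+2) = Σ λᵢ^{m+2} wᵢ` — 't Hooft's
`Tr P(e = 0) e^{−βH}` ((5.2)–(5.4)) for the twist group `(Fin n)³`, `k ↦ (z^{k₀}, z^{k₁}, z^{k₂})`, in a Hilbert eigenbasis of the transfer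
operator adapted to the projection (`W{eTwist z k} = Z^{(zVec z k)}` by `eTwist_eq_elecMag` and `wilsonFinTorusTensorTwistedPartition_elecMag_one`).
[cite: tHooft1979Flux, §5 (5.1)–(5.4)] [cite: MontvayMunster1994, §3.2.6 (3.145)] -/
theorem adaptedSpectralData_projZ (hρ : Continuous ρ) (hρu : ∀ x, ρ x ∈ Matrix.unitaryGroup (Fin N) ℂ) {β : ℝ} (hβ : 0 ≤ β)
    {z : G} (hz : z ∈ Subgroup.center G) {n : ℕ} (hn : 0 < n) (hzn : z ^ n = 1) (L : ℕ) :
    ∃ (ι : Type) (lam w : ι → ℝ), (∀ i, 0 ≤ lam i) ∧ (∀ i, w i = 0 ∨ w i = 1) ∧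
      (∀ m : ℕ, HasSum (fun i => lam i ^ (m + 2)) (wilsonFinTorusPartition ρ β L L L (m + 2))) ∧
      (∀ m : ℕ, HasSum (fun i => lam i ^ (m + 2) * w i) (projZ ρ β z n L (m + 2))) := by
  obtain ⟨q, rfl⟩ : ∃ q, n = q + 1 := ⟨n - 1, by omega⟩
  obtain ⟨ι, lam, w, hlam, hw, hZ, hP⟩ := adaptedSpectralData_twistGroup hρ hρu hβ (Γ := Fin 3 → Fin (q + 1))
    (Z := fun k => zVec z (fun i => (k i : ℕ))) (zVec_fin_zero z q) (zVec_fin_add hzn)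
    (fun k i => zVec_castSucc_mem_center hz _ i) L L L
  refine ⟨ι, lam, w, hlam, hw, hZ, fun m => ?_⟩
  have h := hP m
  unfold projZ
  simp_rw [eTwist_eq_elecMag, wilsonFinTorusTensorTwistedPartition_elecMag_one]
  exact h

/-! ### §3 The spectral reduction of interlacing (stub I of line `flux_interlacing_v2`) -/

/-- ★ **Interlacing from a bound on the charged spectral weight** (the honest spectral form of the conclusion of stub I
`FluxInterlacingEv` ∕ of `InterlacingSC` of line `flux_interlacing_v2` 1bda929b912cc52d; `β ≥ 0`, continuous unitary `ρ`, central `z`,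
`0 < n`, `z ^ n = 1`, `8 ≤ L`, `t = L/4`).  There is an adapted eigenbasis (`λᵢ ≥ 0`, `wᵢ ∈ {0,1}`, `Z = Σ λᵢ^{m+2}`,
`projZ = Σ λᵢ^{m+2} wᵢ`) in which: IF the electric-flux (charged, `wᵢ = 0`) spectral weight at time `t` is at most `κ` times the
neutral excitation, `Σ_{wᵢ=0} λᵢ^t ≤ κ · (Σ_{wᵢ=1} λᵢ^t − √(Σ_{wᵢ=1} λᵢ^{2t}))`, THEN the box is `κ`-interlaced — VERBATIM the body of
`InterlacedAt ρ β z n κ L`: `Z(L³ × t) ≤ projZ(t) + κ · (projZ(t) − √ projZ(2t))`.  (Bookkeeping: `Z − projZ = Σ_{wᵢ=0} λᵢ^t`.)  What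
a prover of I owes is the displayed spectral inequality from neutral `ε₀`-purity — confinement physics, NOT proved here.
[cite: tHooft1979Flux, §5 (5.1)–(5.4)] -/
theorem interlaced_of_chargedWeight_le (hρ : Continuous ρ) (hρu : ∀ x, ρ x ∈ Matrix.unitaryGroup (Fin N) ℂ) {β : ℝ}
    (hβ : 0 ≤ β) {z : G} (hz : z ∈ Subgroup.center G) {n : ℕ} (hn : 0 < n) (hzn : z ^ n = 1) {L : ℕ} (hL : 8 ≤ L) :
    ∃ (ι : Type) (lam w : ι → ℝ), (∀ i, 0 ≤ lam i) ∧ (∀ i, w i = 0 ∨ w i = 1) ∧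
      (∀ m : ℕ, HasSum (fun i => lam i ^ (m + 2)) (wilsonFinTorusPartition ρ β L L L (m + 2))) ∧
      (∀ m : ℕ, HasSum (fun i => lam i ^ (m + 2) * w i) (projZ ρ β z n L (m + 2))) ∧
      ∀ κ : ℝ, ∑' i, lam i ^ (L / 4) * (1 - w i) ≤
          κ * (∑' i, lam i ^ (L / 4) * w i - Real.sqrt (∑' i, lam i ^ (2 * (L / 4)) * w i)) →
        wilsonFinTorusPartition ρ β L L L (L / 4) ≤
          projZ ρ β z n L (L / 4) + κ * (projZ ρ β z n L (L / 4) - Real.sqrt (projZ ρ β z n L (2 * (L / 4)))) := by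
  obtain ⟨ι, lam, w, hlam, hw, hZ, hP⟩ := adaptedSpectralData_projZ hρ hρu hβ hz hn hzn L
  refine ⟨ι, lam, w, hlam, hw, hZ, hP, fun κ hκ => ?_⟩
  obtain ⟨m, hm⟩ : ∃ m, L / 4 = m + 2 := ⟨L / 4 - 2, by omega⟩
  have h3 : HasSum (fun i => lam i ^ (m + 2) * (1 - w i))
      (wilsonFinTorusPartition ρ β L L L (m + 2) - projZ ρ β z n L (m + 2)) := by
    have hfun : (fun i => lam i ^ (m + 2) * (1 - w i)) = fun i => lam i ^ (m + 2) - lam i ^ (m + 2) * w i := by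
      funext i; ring
    rw [hfun]
    exact (hZ m).sub (hP m)
  have e1 : ∑' i, lam i ^ (L / 4) * (1 - w i) = wilsonFinTorusPartition ρ β L L L (L / 4) - projZ ρ β z n L (L / 4) := by
    rw [hm]; exact h3.tsum_eq
  have e2 : ∑' i, lam i ^ (L / 4) * w i = projZ ρ β z n L (L / 4) := by
    rw [hm]; exact (hP m).tsum_eq
  have e3 : ∑' i, lam i ^ (2 * (L / 4)) * w i = projZ ρ β z n L (2 * (L / 4)) := by
    rw [hm, show 2 * (m + 2) = 2 * m + 2 + 2 by ring]; exact (hP (2 * m + 2)).tsum_eq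
  rw [e1, e2, e3] at hκ
  linarith

end Summit.QuantumFields.YangMills.Theorems.IRcofFluxProjectionAdaptedSpectralData

end
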